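import Summits.HodgeConjecture.HodgeConjecture.Theorems.F0P3bHPrincipalSeriesJHOfUTwo            -- ★ p842330: `hPrincipalSeriesJH_of_uTwo` ((N-H-ii′) ⟸ (JH₂))
import Summits.HodgeConjecture.HodgeConjecture.Theorems.F0P3bU2PrincipalSeriesJHOfBricks          -- ★ p842461: junction `uTwoPrincipalSeriesJH_of_bricks (hHC) (hQ) (hEig)`
import Summits.HodgeConjecture.HodgeConjecture.Theorems.F0P3bU2XiQuotientFunctional              -- ★ p843847: (H4) `xi_quotient_functional`
import Summits.HodgeConjecture.HodgeConjecture.Theorems.F0P3bU2NoCharacterEigenvector            -- ★ p842646: (EIG) `no_char_eigenvector_cmPrincipalSeries_two`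
import Summits.HodgeConjecture.HodgeConjecture.Theorems.F0P3bU2PrincipalSeriesHCOfJacquetCriterion -- ★ p843863: (H3) ⟸ (HC₂) `hHC_of_jacquetVanishing_supercuspidal_two`
import Literature.NumberTheory.Automorphic.U2JacquetVanishingSupercuspidalOfCartan                -- ★ p843906: (HC₂) ⟸ (Cartan₂) `jacquetVanishing_isSupercuspidal_two_of_cartan`
import Literature.NumberTheory.Automorphic.UnitaryTwoCartanAnyInvolution                         -- ★ p843938: (Cartan₂) `Two.exists_cartan_of_involution_two`
import HarnessLib

/-!
# (N-H-ii′) `stub_hPrincipalSeriesJH` of line «CMCharIdentityTest» HOLDS — the principal-series branch of `H_v = U(Φ₂) × U(Φ₁)` at a non-split place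

Cell hodgecm-mathlib (FLOOR 0), crux `H413` = `stmt-HodgeConjecture-24833`, line `Cruxes/H413/Lines/F0_P3b_CMCharIdentityTestPaydown.lean`
(ED. 11∕12), joint stub `stub_hPrincipalSeriesJH` (ED. 12: `stub_uTwoPrincipalSeriesJH` + `hPrincipalSeriesJH_of_uTwo`).  THIS FILE (theorems only;
no `def`, no named fact, no `sorry`) closes the whole chain built by this lineage, HYPOTHESIS-FREE:
* `jacquetVanishing_isSupercuspidal_two` — (HC₂) Harish-Chandra's criterion ⇐ for `U(Φ₂)(L⁺_v)` at every non-split `v` (★ `…_of_cartan` fed with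
  ★ `Two.exists_cartan_of_involution_two`);
* `hHC_holds` — (H3) the binder `hHC` of ★ `uTwoPrincipalSeriesJH_of_bricks`;
* `uTwoPrincipalSeriesJH_holds` — (JH₂) = ED. 12's `stub_uTwoPrincipalSeriesJH` VERBATIM (junction at `hHC_holds`, ★ `xi_quotient_functional`,
  ★ `no_char_eigenvector_cmPrincipalSeries_two`);
* `hPrincipalSeriesJH_holds` — (N-H-ii′) = `stub_hPrincipalSeriesJH` VERBATIM (★ `hPrincipalSeriesJH_of_uTwo uTwoPrincipalSeriesJH_holds`).
HONEST LABEL: HC_CM is proved only modulo the 2 remaining named inputs (hLiu418, h413) until rung 0 closes; this file discharges one joint stub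
of one pay-down line of `h413`, nothing more.

## References
* [Rogawski1990] J. D. Rogawski, Ann. of Math. Stud. 123 (1990), §12.1 case (1) pp. 171–172.
* [Casselman1995] W. Casselman, *Introduction to the theory of admissible representations of `p`-adic reductive groups* (1995), Thm. 5.3.1, Cor. 7.1.2.
* [BernsteinZelevinsky1977] I. N. Bernstein, A. V. Zelevinsky, Ann. Sci. ÉNS 10 (1977), §2.
-/

set_option autoImplicit false
set_option linter.dupNamespace false

noncomputable section

open NumberField IsDedekindDomain MeasureTheory Topology
open scoped Matrix MatrixGroups
open Literature.NumberTheory.Rogawski1990 Literature.NumberTheory.Automorphic Literature.NumberTheory.Automorphic.UnitaryGroup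
open Literature.NumberTheory.GaloisRepresentations

namespace Summit.HodgeConjecture.HodgeConjecture.Cruxes.H413.F0P3bHPrincipalSeriesJHHolds

/-- **(HC₂) HARISH-CHANDRA'S CRITERION ⇐ FOR `U(Φ₂)(L⁺_v)` AT EVERY NON-SPLIT PLACE, hypothesis-free**: an irreducible smooth representation of
`U(Φ₂)(L⁺_v)` (`v` non-split in the CM field `L`) whose Jacquet module along `B₂` vanishes is supercuspidal — ★
`jacquetVanishing_isSupercuspidal_two_of_cartan` with its Cartan hypothesis discharged by ★ `Two.exists_cartan_of_involution_two`.
[cite: Casselman1995, Thm. 5.3.1] [cite: Rogawski1990, §12.1 pp. 171–172] -/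
theorem jacquetVanishing_isSupercuspidal_two :
    ∀ (L : Type) [Field L] [NumberField L] [IsCMField L] (v : HeightOneSpectrum (𝓞 ↥(maximalRealSubfield L))),
      (∀ w : PlacesOver L v, IsCMField.complexConj L • w.1 = w.1) →
      ∀ r : SmoothIrrep ↥(unitaryGroupOfForm (conjLocal L (IsCMField.complexConj L) v) (cmLocalForm L 2 v)),
        Subsingleton ((cmBorelTriple L 2 v).restrict r.ρ).Coinvariants → (IrrClass.mk r).IsSupercuspidal :=
  jacquetVanishing_isSupercuspidal_two_of_cartan fun _K _ _ _ _ σ _J hJ hσσ hσv _ϖ hϖ a ha g =>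
    Two.exists_cartan_of_involution_two σ hJ hσσ hσv hϖ a ha g

/-- **(H3) holds**: the binder `hHC` of ★ `F0P3bU2PrincipalSeriesJHOfBricks.uTwoPrincipalSeriesJH_of_bricks` VERBATIM — every irreducible constituent of
`i(χ) = cmPrincipalSeries L 2 v χ` (`v` non-split) has a representative with non-trivial Jacquet module (★ `hHC_of_jacquetVanishing_supercuspidal_two`
at `jacquetVanishing_isSupercuspidal_two`). [cite: Casselman1995, Thm. 5.3.1, Thm. 6.3.5] [cite: BernsteinZelevinsky1977, §2] -/
theorem hHC_holds :
    ∀ (L : Type) [Field L] [NumberField L] [IsCMField L] (v : HeightOneSpectrum (𝓞 ↥(maximalRealSubfield L))),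
      (∀ w : PlacesOver L v, IsCMField.complexConj L • w.1 = w.1) →
      ∀ (χ : ↥(torusU (conjLocal L (IsCMField.complexConj L) v) (cmLocalForm L 2 v)) →* ℂˣ)
        (c : IrrClass ↥(unitaryGroupOfForm (conjLocal L (IsCMField.complexConj L) v) (cmLocalForm L 2 v))),
        c.IsConstituentOf (haveI := locallyCompactSpace_cmBorelU L 2 v; cmPrincipalSeries L 2 v χ) →
        ∃ r : SmoothIrrep ↥(unitaryGroupOfForm (conjLocal L (IsCMField.complexConj L) v) (cmLocalForm L 2 v)),
          IrrClass.mk r = c ∧ Nontrivial ((cmBorelTriple L 2 v).restrict r.ρ).Coinvariants :=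
  F0P3bU2PrincipalSeriesHCOfJacquetCriterion.hHC_of_jacquetVanishing_supercuspidal_two jacquetVanishing_isSupercuspidal_two

/-- **(JH₂) holds** — the binder `hJH₂` of ★ `hPrincipalSeriesJH_of_uTwo` (= ED. 12's `stub_uTwoPrincipalSeriesJH`) VERBATIM: for `ξ₂ ⊠ χH₁`-data at a
non-split `v`, `JH(i(χH₂)) = {⟦ℂ_{ξ₂}⟧, πSt₂}` exactly and `i(χH₂)` has no chain `⊥ < N₁ < N₂ < ⊤` — the junction ★ `uTwoPrincipalSeriesJH_of_bricks`
at `hHC_holds`, ★ `xi_quotient_functional` (H4), ★ `no_char_eigenvector_cmPrincipalSeries_two` (EIG).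
[cite: Rogawski1990, §12.1 case (1) pp. 171–172] [cite: Casselman1995, Cor. 7.1.2] -/
theorem uTwoPrincipalSeriesJH_holds :
    ∀ (L : Type) [Field L] [NumberField L] [IsCMField L] (v : HeightOneSpectrum (𝓞 ↥(maximalRealSubfield L))) (ξ : OneDimAutRepH L),
      (∀ w : PlacesOver L v, IsCMField.complexConj L • w.1 = w.1) →
      ∀ hξ₂ : IsOpen (((((ξ.xiLocalChar v).comp (MonoidHom.inl ((cmDatum L 2 (Matrix.of fun i j : Fin 2 => if i.val + j.val + 1 = 2 then (1 : L) else 0)).Local v) ((cmDatum L 1 (Matrix.of fun i j : Fin 1 => if i.val + j.val + 1 = 1 then (1 : L) else 0)).Local v))).ker :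
          Subgroup ((cmDatum L 2 (Matrix.of fun i j : Fin 2 => if i.val + j.val + 1 = 2 then (1 : L) else 0)).Local v)) : Set ((cmDatum L 2 (Matrix.of fun i j : Fin 2 => if i.val + j.val + 1 = 2 then (1 : L) else 0)).Local v))),
      ∃ πSt₂ : IrrClass ((cmDatum L 2 (Matrix.of fun i j : Fin 2 => if i.val + j.val + 1 = 2 then (1 : L) else 0)).Local v),
        πSt₂ ≠ IrrClass.mk (SmoothIrrep.ofChar ((ξ.xiLocalChar v).comp (MonoidHom.inl ((cmDatum L 2 (Matrix.of fun i j : Fin 2 => if i.val + j.val + 1 = 2 then (1 : L) else 0)).Local v) ((cmDatum L 1 (Matrix.of fun i j : Fin 1 => if i.val + j.val + 1 = 1 then (1 : L) else 0)).Local v))) hξ₂) ∧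
        (∀ c : IrrClass ((cmDatum L 2 (Matrix.of fun i j : Fin 2 => if i.val + j.val + 1 = 2 then (1 : L) else 0)).Local v),
          c.IsConstituentOf (haveI := locallyCompactSpace_cmBorelU L 2 v; cmPrincipalSeries L 2 v
            (torusCharPair (conjLocal L (IsCMField.complexConj L) v) (cmLocalForm L 2 v) (cmLocalForm_eq_over L 2 v) 0
            ((torusLocalComponent L (IsCMField.complexConj L) v ξ.η).comp
                (quotConj (conjLocal L (IsCMField.complexConj L) v) (conjLocal_conjLocal_cm L v)) *
              halfModulusChar (UnitaryGroup.LocalRing L v))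
            (torusLocalComponent L (IsCMField.complexConj L) v ξ.ψ))) ↔
            (c = IrrClass.mk (SmoothIrrep.ofChar ((ξ.xiLocalChar v).comp (MonoidHom.inl ((cmDatum L 2 (Matrix.of fun i j : Fin 2 => if i.val + j.val + 1 = 2 then (1 : L) else 0)).Local v) ((cmDatum L 1 (Matrix.of fun i j : Fin 1 => if i.val + j.val + 1 = 1 then (1 : L) else 0)).Local v))) hξ₂) ∨ c = πSt₂)) ∧
        (∀ N₁ N₂ : Subrepresentation (haveI := locallyCompactSpace_cmBorelU L 2 v; cmPrincipalSeries L 2 v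
            (torusCharPair (conjLocal L (IsCMField.complexConj L) v) (cmLocalForm L 2 v) (cmLocalForm_eq_over L 2 v) 0
            ((torusLocalComponent L (IsCMField.complexConj L) v ξ.η).comp
                (quotConj (conjLocal L (IsCMField.complexConj L) v) (conjLocal_conjLocal_cm L v)) *
              halfModulusChar (UnitaryGroup.LocalRing L v))
            (torusLocalComponent L (IsCMField.complexConj L) v ξ.ψ))),
          ¬ (⊥ < N₁ ∧ N₁ < N₂ ∧ N₂ < ⊤)) :=
  F0P3bU2PrincipalSeriesJHOfBricks.uTwoPrincipalSeriesJH_of_bricks hHC_holds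
    F0P3bU2XiQuotientFunctional.xi_quotient_functional
    F0P3bU2NoCharacterEigenvector.no_char_eigenvector_cmPrincipalSeries_two

/-- **(N-H-ii′) HOLDS — `stub_hPrincipalSeriesJH` of `Cruxes/H413/Lines/F0_P3b_CMCharIdentityTestPaydown.lean` VERBATIM, hypothesis-free**:
at a non-split `v`, the trace of the transported principal-series representation of `H_v = U(Φ₂)(L⁺_v) × U(Φ₁)(L⁺_v)` attached to `ξ`
splits as `tr ℂ_{ξ_v} + tr πSt` with `πSt ≠ ⟦ℂ_{ξ_v}⟧` — ★ `hPrincipalSeriesJH_of_uTwo` at `uTwoPrincipalSeriesJH_holds`.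
[cite: Rogawski1990, §12.1 case (1) pp. 171–172] [cite: Casselman1995, Cor. 7.1.2] -/
theorem hPrincipalSeriesJH_holds :
  ∀ (L : Type) [Field L] [NumberField L] [IsCMField L] (v : HeightOneSpectrum (𝓞 ↥(maximalRealSubfield L)))
    [MeasurableSpace (((cmDatum L 2 (Matrix.of fun i j : Fin 2 => if i.val + j.val + 1 = 2 then (1 : L) else 0)).Local v) × ((cmDatum L 1 (Matrix.of fun i j : Fin 1 => if i.val + j.val + 1 = 1 then (1 : L) else 0)).Local v))] [BorelSpace (((cmDatum L 2 (Matrix.of fun i j : Fin 2 => if i.val + j.val + 1 = 2 then (1 : L) else 0)).Local v) × ((cmDatum L 1 (Matrix.of fun i j : Fin 1 => if i.val + j.val + 1 = 1 then (1 : L) else 0)).Local v))]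
    (νH : Measure (((cmDatum L 2 (Matrix.of fun i j : Fin 2 => if i.val + j.val + 1 = 2 then (1 : L) else 0)).Local v) × ((cmDatum L 1 (Matrix.of fun i j : Fin 1 => if i.val + j.val + 1 = 1 then (1 : L) else 0)).Local v))) [νH.IsHaarMeasure] [νH.IsMulRightInvariant]
    (ξ : OneDimAutRepH L), (∀ w : PlacesOver L v, IsCMField.complexConj L • w.1 = w.1) →
      ∃ πSt : IrrClass (((cmDatum L 2 (Matrix.of fun i j : Fin 2 => if i.val + j.val + 1 = 2 then (1 : L) else 0)).Local v) × ((cmDatum L 1 (Matrix.of fun i j : Fin 1 => if i.val + j.val + 1 = 1 then (1 : L) else 0)).Local v)),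
        ∃ hker : IsOpen ((((ξ.xiLocalChar v).ker : Subgroup (((cmDatum L 2 (Matrix.of fun i j : Fin 2 => if i.val + j.val + 1 = 2 then (1 : L) else 0)).Local v) × ((cmDatum L 1 (Matrix.of fun i j : Fin 1 => if i.val + j.val + 1 = 1 then (1 : L) else 0)).Local v))) : Set (((cmDatum L 2 (Matrix.of fun i j : Fin 2 => if i.val + j.val + 1 = 2 then (1 : L) else 0)).Local v) × ((cmDatum L 1 (Matrix.of fun i j : Fin 1 => if i.val + j.val + 1 = 1 then (1 : L) else 0)).Local v)))),
        HLengthTwoLabels L v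
          (torusCharPair (conjLocal L (IsCMField.complexConj L) v) (cmLocalForm L 2 v) (cmLocalForm_eq_over L 2 v) 0
            ((torusLocalComponent L (IsCMField.complexConj L) v ξ.η).comp
                (quotConj (conjLocal L (IsCMField.complexConj L) v) (conjLocal_conjLocal_cm L v)) *
              halfModulusChar (UnitaryGroup.LocalRing L v))
            (torusLocalComponent L (IsCMField.complexConj L) v ξ.ψ))
          ((torusLocalComponent L (IsCMField.complexConj L) v ξ.ψ).comp (localDet (IsCMField.complexConj L) v (isUnit_antidiagOne_det L 1)))
            (IrrClass.mk (SmoothIrrep.ofChar (ξ.xiLocalChar v) hker)) πSt ∧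
        (∀ fH : ((cmDatum L 2 (Matrix.of fun i j : Fin 2 => if i.val + j.val + 1 = 2 then (1 : L) else 0)).Local v) × ((cmDatum L 1 (Matrix.of fun i j : Fin 1 => if i.val + j.val + 1 = 1 then (1 : L) else 0)).Local v) → ℂ, IsLocSmooth fH →
          Representation.smoothTrace
              (UnitaryGroup.cmPrincipalSeriesH L v
                (torusCharPair (conjLocal L (IsCMField.complexConj L) v) (cmLocalForm L 2 v) (cmLocalForm_eq_over L 2 v) 0
            ((torusLocalComponent L (IsCMField.complexConj L) v ξ.η).comp
                (quotConj (conjLocal L (IsCMField.complexConj L) v) (conjLocal_conjLocal_cm L v)) *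
              halfModulusChar (UnitaryGroup.LocalRing L v))
            (torusLocalComponent L (IsCMField.complexConj L) v ξ.ψ))
                ((torusLocalComponent L (IsCMField.complexConj L) v ξ.ψ).comp (localDet (IsCMField.complexConj L) v (isUnit_antidiagOne_det L 1))))
              νH fH =
            (IrrClass.mk (SmoothIrrep.ofChar (ξ.xiLocalChar v) hker)).smoothTrace νH fH + πSt.smoothTrace νH fH) :=
  F0P3bHPrincipalSeriesJHOfUTwo.hPrincipalSeriesJH_of_uTwo uTwoPrincipalSeriesJH_holds

end Summit.HodgeConjecture.HodgeConjecture.Cruxes.H413.F0P3bHPrincipalSeriesJHHolds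

end
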